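import Summits.KontsevichZagierPeriods.KontsevichZagierPeriods.Theses.HurwitzMicroSectors
import Summits.KontsevichZagierPeriods.KontsevichZagierPeriods.Theorems.HurwitzMicroSectorsNormalFormPrinciplePiBoxTransfer

/-! TTRL-lite variant V2215 of stmt-KontsevichZagierPeriods-3869

Variant V2215 = `stub_boxRigidity` (BoxRigidity: two box-rational representations — domain the open
unit box, integrand `p/q` over `ℚ` — with equal values are KZ-equivalent) with BOTH dimensions frozen,
`fix_nat:m=2; fix_nat:m'=4`. Verdict of the attempt seat: **open** — this file is the exact-strength
certificate, not a proof of the variant. Freezing both dimensions to `j`, `k` pins the leaf to ONE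
dimension: the frozen instance is equivalent to BoxVanishing in the LARGER of the two dimensions
(every box-rational representation on that box of value `0` is a relation), i.e. to Conjecture 1 for
box-rational periods of that single dimension (`boxRigidityFix_iff_boxVanishing_snd` for `j ≤ k`,
`boxRigidityFix_iff_boxVanishing_fst` for `k ≤ j`, general `j`, `k`): one way, compare a representation
of value `0` with the zero representation on the other box (box-rational, value `0`, itself a relation;
`boxVanishing_fst_of_boxRigidityFix`, `boxVanishing_snd_of_boxRigidityFix`); the other way, pad both
representations to a common box by unit intervals (`pad_le`, tree: Newton–Leibniz + null faces) and
subtract the integrands (`sub_same`, tree, rule 1b)) — the difference has value `0` by soundness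
(`boxRigidityFix_of_boxVanishing`). For V2215 the dimension is `4`
(`stub_boxRigidity_var2215_iff_boxVanishing_four`); the frozen values matter only through the larger
one, so V2215 is also BoxRigidity under the joint bound `m, m' ≤ 4`
(`stub_boxRigidity_var2215_iff_le_four`; cf. `boxRigidityLe_iff_boxVanishing` of file `…Variants2239`
for the bounded moves). It is Conjecture 1 for the periods `∫_{(0,1)⁴} p/q` — among
them `π⁴`, `ζ(4)`, `π·ζ(3)`, `ζ(2)·log² 2`, … — and already its dimension-`2` consequence
(`boxVanishing_two_of_stub_boxRigidity_var2215`, `boxRigidity_two_two_of_stub_boxRigidity_var2215`)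
decides every `ℚ`-linear relation among the box periods `∫∫_{(0,1)²} p/q` (`π log 2`, `log² 2`,
Catalan's `G = ∫∫ dx dy/(1+x²y²)`, `Li₂` and Clausen values, …), whose arithmetic nature is unknown; no
argument in the tree or the literature proves it, and `KontsevichZagierPeriods → V2215`
(`stub_boxRigidity_var2215_of_statement`), so a refutation would refute the Summit. In the sibling
lattice: parent `⇒ V2215 (BoxVanishing 4) ⇒ V2239/V2349 (BoxVanishing 3) ⇒ V2204/V2338 (BoxVanishing 2)`
(`boxVanishing_three_of_stub_boxRigidity_var2215`). (The two-sided instances with both dimensions `≤ 1` are the theorem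
`boxRigidity_of_le_one`, by Baker; dimension `2` is the first open one.)
Source: M. Kontsevich, D. Zagier, *Periods* (2001), §1.2 Conjecture 1 and rules 1)–3).
Pure proof file, no definitions. -/

-- `Summit.<Summit>.<Problem>` is the tree's mandated summit-side namespace (CONVENTIONS §2); for this
-- single-conjunct summit the two coincide, so the duplicate is deliberate.
set_option linter.dupNamespace false

noncomputable section

namespace Summit.KontsevichZagierPeriods.KontsevichZagierPeriods.Theorems

open MeasureTheory Set
open Literature.NumberTheory.Transcendental Literature.NumberTheory.Transcendental.KZ
open Summit.KontsevichZagierPeriods.KontsevichZagierPeriods.Theses.HurwitzMicroSectors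
open Summit.KontsevichZagierPeriods.HurwitzMicroSectors.NormalFormPrinciple.PiBox
open Summit.KontsevichZagierPeriods.HurwitzMicroSectors.NormalFormPrinciple.PiBox.stub_boxCombineAux

/-! ## Two frozen dimensions are one dimension -/

/-- **BoxRigidity at frozen dimensions `(j, k)` gives BoxVanishing in dimension `j`**: compare a
box-rational representation of dimension `j` and value `0` with the zero representation on the
`k`-box (box-rational, value `0`, itself a relation). [cite: KontsevichZagier2001, §1.2 Conjecture 1] -/
theorem boxVanishing_fst_of_boxRigidityFix {j k : ℕ}
    (hrig : ∀ (N : IntegralRep j) (N' : IntegralRep k),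
      N.domain = {x | ∀ i, x i ∈ Set.Ioo (0:ℝ) 1} → N.IsRational →
      N'.domain = {x | ∀ i, x i ∈ Set.Ioo (0:ℝ) 1} → N'.IsRational →
      N.value = N'.value → Equivalent N N')
    (N : IntegralRep j) (hNd : N.domain = {x | ∀ i, x i ∈ Set.Ioo (0:ℝ) 1}) (hNr : N.IsRational)
    (hv : N.value = 0) : of N ∈ relations := by
  obtain ⟨Z, hZd, hZi⟩ := exists_zeroRep (isSemialgebraic_box k)
  have hZ : of Z ∈ relations := of_mem_relations_of_eqOn_zero Z (by simp [hZi, EqOn])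
  have hZv : Z.value = 0 := by simp [IntegralRep.value, hZi]
  have hZr : Z.IsRational := ⟨0, 1, fun x _ => by simp, fun x _ => by simp [hZi]⟩
  have h : of N - of Z ∈ relations := hrig N Z hNd hNr hZd hZr (by rw [hv, hZv])
  simpa using relations.add_mem h hZ

/-- **BoxRigidity at frozen dimensions `(j, k)` gives BoxVanishing in dimension `k`**: compare the
zero representation on the `j`-box with a box-rational representation of dimension `k` and value `0`.
[cite: KontsevichZagier2001, §1.2 Conjecture 1] -/
theorem boxVanishing_snd_of_boxRigidityFix {j k : ℕ}
    (hrig : ∀ (N : IntegralRep j) (N' : IntegralRep k),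
      N.domain = {x | ∀ i, x i ∈ Set.Ioo (0:ℝ) 1} → N.IsRational →
      N'.domain = {x | ∀ i, x i ∈ Set.Ioo (0:ℝ) 1} → N'.IsRational →
      N.value = N'.value → Equivalent N N')
    (N : IntegralRep k) (hNd : N.domain = {x | ∀ i, x i ∈ Set.Ioo (0:ℝ) 1}) (hNr : N.IsRational)
    (hv : N.value = 0) : of N ∈ relations := by
  obtain ⟨Z, hZd, hZi⟩ := exists_zeroRep (isSemialgebraic_box j)
  have hZ : of Z ∈ relations := of_mem_relations_of_eqOn_zero Z (by simp [hZi, EqOn])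
  have hZv : Z.value = 0 := by simp [IntegralRep.value, hZi]
  have hZr : Z.IsRational := ⟨0, 1, fun x _ => by simp, fun x _ => by simp [hZi]⟩
  have h : of Z - of N ∈ relations := hrig Z N hZd hZr hNd hNr (by rw [hv, hZv])
  have := relations.sub_mem hZ h
  rwa [sub_sub_cancel] at this

/-- **BoxVanishing in a dimension `K ≥ j, k` gives BoxRigidity at the frozen dimensions `(j, k)`**:
pad both representations to the `K`-box (`pad_le`), subtract the integrands on the common box
(`sub_same`, rule 1b)); the difference representation has value `0` by soundness, hence is a
relation. [cite: KontsevichZagier2001, §1.2] -/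
theorem boxRigidityFix_of_boxVanishing {j k K : ℕ} (hj : j ≤ K) (hk : k ≤ K)
    (hvan : ∀ N : IntegralRep K, N.domain = {x | ∀ i, x i ∈ Set.Ioo (0:ℝ) 1} → N.IsRational →
      N.value = 0 → of N ∈ relations) :
    ∀ (N : IntegralRep j) (N' : IntegralRep k),
      N.domain = {x | ∀ i, x i ∈ Set.Ioo (0:ℝ) 1} → N.IsRational →
      N'.domain = {x | ∀ i, x i ∈ Set.Ioo (0:ℝ) 1} → N'.IsRational →
      N.value = N'.value → Equivalent N N' := by
  intro N N' hNd hNr hN'd hN'r hv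
  obtain ⟨R₁, h₁d, h₁r, h₁⟩ := pad_le hj N hNd hNr
  obtain ⟨R₂, h₂d, h₂r, h₂⟩ := pad_le hk N' hN'd hN'r
  obtain ⟨M, hMd, hMr, hM⟩ := sub_same R₁ R₂ h₁d h₁r h₂d h₂r
  have hMv : M.value = 0 := by
    have e₁ := relations_le_ker_eval_holds h₁
    have e₂ := relations_le_ker_eval_holds h₂
    have e := relations_le_ker_eval_holds hM
    simp only [AddMonoidHom.mem_ker, map_sub, eval_of] at e₁ e₂ e
    linarith
  have e : of N - of N' = (of N - of R₁) - (of N' - of R₂) + (of R₁ - of R₂ - of M) + of M := by abel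
  show of N - of N' ∈ relations
  rw [e]
  exact relations.add_mem (relations.add_mem (relations.sub_mem h₁ h₂) hM) (hvan M hMd hMr hMv)

/-- **Two frozen dimensions are the larger one (case `j ≤ k`):
`BoxRigidity (m = j, m' = k) ⟺ BoxVanishing k`.** So the programmatic move
`fix_nat:m=j; fix_nat:m'=k` of `stub_boxRigidity` produces exactly Conjecture 1 for box-rational
periods of the larger dimension: a theorem up to dimension `1` (`boxRigidity_of_le_one`, Baker), open
from dimension `2` on. [cite: KontsevichZagier2001, §1.2 Conjecture 1] -/
theorem boxRigidityFix_iff_boxVanishing_snd {j k : ℕ} (hjk : j ≤ k) :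
    (∀ (N : IntegralRep j) (N' : IntegralRep k),
      N.domain = {x | ∀ i, x i ∈ Set.Ioo (0:ℝ) 1} → N.IsRational →
      N'.domain = {x | ∀ i, x i ∈ Set.Ioo (0:ℝ) 1} → N'.IsRational →
      N.value = N'.value → Equivalent N N') ↔
    (∀ N : IntegralRep k, N.domain = {x | ∀ i, x i ∈ Set.Ioo (0:ℝ) 1} → N.IsRational →
      N.value = 0 → of N ∈ relations) :=
  ⟨fun h => boxVanishing_snd_of_boxRigidityFix h, fun h => boxRigidityFix_of_boxVanishing hjk le_rfl h⟩

/-- **Two frozen dimensions are the larger one (case `k ≤ j`):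
`BoxRigidity (m = j, m' = k) ⟺ BoxVanishing j`.** [cite: KontsevichZagier2001, §1.2 Conjecture 1] -/
theorem boxRigidityFix_iff_boxVanishing_fst {j k : ℕ} (hkj : k ≤ j) :
    (∀ (N : IntegralRep j) (N' : IntegralRep k),
      N.domain = {x | ∀ i, x i ∈ Set.Ioo (0:ℝ) 1} → N.IsRational →
      N'.domain = {x | ∀ i, x i ∈ Set.Ioo (0:ℝ) 1} → N'.IsRational →
      N.value = N'.value → Equivalent N N') ↔
    (∀ N : IntegralRep j, N.domain = {x | ∀ i, x i ∈ Set.Ioo (0:ℝ) 1} → N.IsRational →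
      N.value = 0 → of N ∈ relations) :=
  ⟨fun h => boxVanishing_fst_of_boxRigidityFix h, fun h => boxRigidityFix_of_boxVanishing le_rfl hkj h⟩

/-- **Frozen rigidity is monotone in the pair of dimensions**: BoxRigidity at `(K, K)` gives
BoxRigidity at every `(j, k)` with `j, k ≤ K` (through BoxVanishing `K` and padding). In particular
BoxVanishing descends along padding. [cite: KontsevichZagier2001, §1.2] -/
theorem boxRigidityFix_anti {j k K : ℕ} (hj : j ≤ K) (hk : k ≤ K)
    (hrig : ∀ (N N' : IntegralRep K),
      N.domain = {x | ∀ i, x i ∈ Set.Ioo (0:ℝ) 1} → N.IsRational →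
      N'.domain = {x | ∀ i, x i ∈ Set.Ioo (0:ℝ) 1} → N'.IsRational →
      N.value = N'.value → Equivalent N N') :
    ∀ (N : IntegralRep j) (N' : IntegralRep k),
      N.domain = {x | ∀ i, x i ∈ Set.Ioo (0:ℝ) 1} → N.IsRational →
      N'.domain = {x | ∀ i, x i ∈ Set.Ioo (0:ℝ) 1} → N'.IsRational →
      N.value = N'.value → Equivalent N N' :=
  boxRigidityFix_of_boxVanishing hj hk (boxVanishing_fst_of_boxRigidityFix hrig)

/-! ## The variant V2215 itself: Conjecture 1 for box-rational periods of dimension 4 -/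

/-- **V2215 ⟺ BoxVanishing in dimension `4`** (every box-rational representation on `(0,1)⁴` of
value `0` is a relation): from V2215, compare with the zero representation on the `2`-box; conversely
pad the `2`-dimensional representation to the `4`-box by two unit intervals and subtract.
[cite: KontsevichZagier2001, §1.2 Conjecture 1] -/
theorem stub_boxRigidity_var2215_iff_boxVanishing_four :
    (∀ (N : IntegralRep 2) (N' : IntegralRep 4), N.domain = {x | ∀ i, x i ∈ Set.Ioo (0:ℝ) 1} → N.IsRational → N'.domain = {x | ∀ i, x i ∈ Set.Ioo (0:ℝ) 1} → N'.IsRational → N.value = N'.value → Equivalent N N') ↔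
    (∀ N : IntegralRep 4, N.domain = {x | ∀ i, x i ∈ Set.Ioo (0:ℝ) 1} → N.IsRational →
      N.value = 0 → of N ∈ relations) :=
  ⟨fun h => boxVanishing_snd_of_boxRigidityFix h,
    fun h => boxRigidityFix_of_boxVanishing (by norm_num) le_rfl h⟩

/-- **V2215 ⟺ BoxRigidity under the joint bound `m, m' ≤ 4`** (both are BoxVanishing in dimension
`4`; the frozen values `2`, `4` matter only through the larger one). [cite: KontsevichZagier2001, §1.2 Conjecture 1] -/
theorem stub_boxRigidity_var2215_iff_le_four :
    (∀ (N : IntegralRep 2) (N' : IntegralRep 4), N.domain = {x | ∀ i, x i ∈ Set.Ioo (0:ℝ) 1} → N.IsRational → N'.domain = {x | ∀ i, x i ∈ Set.Ioo (0:ℝ) 1} → N'.IsRational → N.value = N'.value → Equivalent N N') ↔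
    (∀ (m m' : ℕ) (N : IntegralRep m) (N' : IntegralRep m'), m' ≤ 4 → m ≤ 4 →
      N.domain = {x | ∀ i, x i ∈ Set.Ioo (0:ℝ) 1} → N.IsRational →
      N'.domain = {x | ∀ i, x i ∈ Set.Ioo (0:ℝ) 1} → N'.IsRational →
      N.value = N'.value → Equivalent N N') :=
  ⟨fun h _ _ N N' hm' hm =>
      boxRigidityFix_of_boxVanishing hm hm' (stub_boxRigidity_var2215_iff_boxVanishing_four.1 h) N N',
    fun h N N' => h 2 4 N N' le_rfl (by norm_num)⟩

/-- **V2215 ⇒ BoxVanishing in dimension `3`**, i.e. V2215 implies the sibling variants V2239 / V2349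
(BoxVanishing `3`): BoxVanishing descends `4 → 3` along padding (through frozen rigidity at `(3, 3)`). [cite: KontsevichZagier2001, §1.2 Conjecture 1] -/
theorem boxVanishing_three_of_stub_boxRigidity_var2215
    (h : ∀ (N : IntegralRep 2) (N' : IntegralRep 4), N.domain = {x | ∀ i, x i ∈ Set.Ioo (0:ℝ) 1} → N.IsRational → N'.domain = {x | ∀ i, x i ∈ Set.Ioo (0:ℝ) 1} → N'.IsRational → N.value = N'.value → Equivalent N N')
    (N : IntegralRep 3) (hNd : N.domain = {x | ∀ i, x i ∈ Set.Ioo (0:ℝ) 1}) (hNr : N.IsRational)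
    (hv : N.value = 0) : of N ∈ relations :=
  boxVanishing_fst_of_boxRigidityFix (k := 3)
    (boxRigidityFix_of_boxVanishing (by norm_num) (by norm_num)
      (stub_boxRigidity_var2215_iff_boxVanishing_four.1 h)) N hNd hNr hv

/-- **V2215 ⇒ BoxVanishing in dimension `2`**: the variant already decides every `ℚ`-linear relation
among the box periods `∫∫_{(0,1)²} p/q` (`π log 2`, `log² 2`, Catalan's `G`, `Li₂` and Clausen values …)
in favour of the calculus — the first dimension where this is open. Directly: compare with the zero
representation on the `4`-box. [cite: KontsevichZagier2001, §1.2 Conjecture 1] -/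
theorem boxVanishing_two_of_stub_boxRigidity_var2215
    (h : ∀ (N : IntegralRep 2) (N' : IntegralRep 4), N.domain = {x | ∀ i, x i ∈ Set.Ioo (0:ℝ) 1} → N.IsRational → N'.domain = {x | ∀ i, x i ∈ Set.Ioo (0:ℝ) 1} → N'.IsRational → N.value = N'.value → Equivalent N N')
    (N : IntegralRep 2) (hNd : N.domain = {x | ∀ i, x i ∈ Set.Ioo (0:ℝ) 1}) (hNr : N.IsRational)
    (hv : N.value = 0) : of N ∈ relations :=
  boxVanishing_fst_of_boxRigidityFix h N hNd hNr hv

/-- **V2215 ⇒ BoxRigidity in dimension `(2, 2)`**: two box-rational double integrals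
`∫∫_{(0,1)²} p/q`, `∫∫_{(0,1)²} p'/q'` with equal values are KZ-equivalent (e.g. KZ's
`∫∫ dx dy/(1−xy)` and `(8/3)∫∫ dx dy/((1+x²)(1+y²))`, both `π²/6`). [cite: KontsevichZagier2001, §1.2 Conjecture 1] -/
theorem boxRigidity_two_two_of_stub_boxRigidity_var2215
    (h : ∀ (N : IntegralRep 2) (N' : IntegralRep 4), N.domain = {x | ∀ i, x i ∈ Set.Ioo (0:ℝ) 1} → N.IsRational → N'.domain = {x | ∀ i, x i ∈ Set.Ioo (0:ℝ) 1} → N'.IsRational → N.value = N'.value → Equivalent N N') :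
    ∀ (N N' : IntegralRep 2), N.domain = {x | ∀ i, x i ∈ Set.Ioo (0:ℝ) 1} → N.IsRational →
      N'.domain = {x | ∀ i, x i ∈ Set.Ioo (0:ℝ) 1} → N'.IsRational →
      N.value = N'.value → Equivalent N N' :=
  boxRigidityFix_of_boxVanishing (by norm_num) (by norm_num)
    (stub_boxRigidity_var2215_iff_boxVanishing_four.1 h)

/-- **`KontsevichZagierPeriods ⇒ V2215`**: the variant is a special case of Conjecture 1 for the
tree's calculus — so a refutation of the variant would refute the Summit.
[cite: KontsevichZagier2001, §1.2 Conjecture 1] -/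
theorem stub_boxRigidity_var2215_of_statement (h : _root_.KontsevichZagierPeriods) :
    ∀ (N : IntegralRep 2) (N' : IntegralRep 4), N.domain = {x | ∀ i, x i ∈ Set.Ioo (0:ℝ) 1} → N.IsRational → N'.domain = {x | ∀ i, x i ∈ Set.Ioo (0:ℝ) 1} → N'.IsRational → N.value = N'.value → Equivalent N N' :=
  fun N N' => (leaves_of_statement h).1 2 4 N N'

/-- **The parent leaf ⇒ V2215** (the variant is a specialisation of `stub_boxRigidity`; the converse
is not claimed — the parent is BoxVanishing in ALL dimensions, the variant only in dimension `4`).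
[cite: KontsevichZagier2001, §1.2 Conjecture 1] -/
theorem stub_boxRigidity_var2215_of_parent
    (h : ∀ (m m' : ℕ) (N : IntegralRep m) (N' : IntegralRep m'), N.domain = {x | ∀ i, x i ∈ Set.Ioo (0:ℝ) 1} → N.IsRational → N'.domain = {x | ∀ i, x i ∈ Set.Ioo (0:ℝ) 1} → N'.IsRational → N.value = N'.value → Equivalent N N') :
    ∀ (N : IntegralRep 2) (N' : IntegralRep 4), N.domain = {x | ∀ i, x i ∈ Set.Ioo (0:ℝ) 1} → N.IsRational → N'.domain = {x | ∀ i, x i ∈ Set.Ioo (0:ℝ) 1} → N'.IsRational → N.value = N'.value → Equivalent N N' :=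
  fun N N' => h 2 4 N N'

end Summit.KontsevichZagierPeriods.KontsevichZagierPeriods.Theorems
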